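import Literature.AnabelianGeometry.SemiGraphs.Example28CoverticialProofs
import Literature.AnabelianGeometry.SemiGraphs.ProperBranchLifting
import Literature.AnabelianGeometry.Anabelioids.ComponentsOrbits
import Mathlib.CategoryTheory.Galois.Prorepresentability
import HarnessLib

/-!
# [SemiAnbd] Example 2.8, coverticial half — the necessity direction for a non-loop, PROVED

Mochizuki, *Semi-graphs of anabelioids*, Publ. RIMS **42** (2006) 221–322, §2, Example 2.8, author's
manuscript p. 31 [cite: MochizukiSemiAnbd2006, Ex. 2.8 p.31]: "a closed edge abutting to vertices
`v`, `w` is sub-coverticial … [only if] both `Π_v` and `Π_w` are nontrivial".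

PROOF-ONLY companion (abc-iut cell, layer L3, row W4-31; named fact
`SemiGraphOfAnabelioids.example_2_8_coverticial` of `Coverticial.lean` rev 4, FACT-LIST F-1474,
statement owner abc-iut-L3-t1; sequel of `Example28CoverticialProofs.lean`).  The "only if" of the
first conjunct holds for edges joining two DISTINCT vertices (it fails at loops, d075-S1 /
`Example28CoverticialLoopCounterexample.lean`), and does not even need the triviality of the edge
anabelioids:

* `SemiGraphOfAnabelioids.nontrivial_of_isSubCoverticial_of_ne` — if `e` joins `v ≠ w` and `e` is
  sub-coverticial, then `Π_v` is nontrivial (at every basepoint); symmetrically for `Π_w`;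
* `SemiGraphOfAnabelioids.isSubCoverticial_iff_of_ne` — hence, with trivial edge anabelioids and
  `v ≠ w`, the first conjunct of Ex. 2.8 holds verbatim: `e` is sub-coverticial iff `Π_v` and `Π_w`
  are nontrivial (the sufficiency being `isSubCoverticial_of_nontrivial` of the prequel).

Argument (print: "one verifies immediately"): if `Π_v = 1` and `φ : 𝒢' → 𝒢` is a finite étale
covering attached to `A = {S_u, T_f, ψ_β}`, two coverticial edges `e₁ ≠ e₂` over `e` meet a common
vertex `x` over `v` through branches over the branch `b` of `e` at `v` (branch lifting over the proper
base morphism, abc-iut-L6-d5 / abc-iut-L6-t17; here `v ≠ w` is used); by the position clause of the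
local description both components `cE(eᵢ) ⊆ T_e` lie under `ψ_b(b^* P)`, `P = cV(x) ⊆ S_v` a
CONNECTED object of `𝒢_v`, whose fibre is a single point because `Π_v = 1` acts transitively on it;
so the two components share a fibre point and coincide — contradicting the bijectivity of `cE`.
The transport-along-edges bookkeeping is adapted from abc-iut-L6-t17's `CoverticialCoveringBranchCount`.
No definition; nothing here takes a side on [IUTchIII] Cor. 3.12.
-/

namespace Literature.AnabelianGeometry.SemiGraphs

open CategoryTheory CategoryTheory.Limits CategoryTheory.PreGaloisCategory
open Literature.AnabelianGeometry.Anabelioids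

universe v₁ u₁ u

namespace SemiGraphOfAnabelioids

variable {𝒢 𝒢' : SemiGraphOfAnabelioids.{v₁, u₁, u}}

/-! ### Transport bookkeeping (adapted from `CoverticialCoveringBranchCount`, abc-iut-L6-t17) -/

/-- `⟨e₁, h ▸ Q⟩ = ⟨e₂, Q⟩` in the Σ-type of edge components.
[cite: MochizukiSemiAnbd2006, Def. 2.2(i) p.23] -/
private theorem sigma_mk_eqRec_T (A : 𝒢.BObj) {e₁ e₂ : 𝒢.graph.Edge} (h : e₁ = e₂)
    (Q : π₀Obj (A.T e₂)) :
    (⟨e₁, (h ▸ Q : π₀Obj (A.T e₁))⟩ : Σ e, π₀Obj (A.T e)) = ⟨e₂, Q⟩ := by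
  subst h
  rfl

/-- A transported component is still connected (it is the same subobject).
[cite: MochizukiSemiAnbd2006, Def. 2.2(i) p.23] -/
private theorem isConnected_eqRec_T (A : 𝒢.BObj) {e₁ e₂ : 𝒢.graph.Edge} (h : e₁ = e₂)
    (Q : π₀Obj (A.T e₂)) : PreGaloisCategory.IsConnected ((h ▸ Q : π₀Obj (A.T e₁)).1 : 𝒢.E e₁) := by
  subst h
  exact Q.2

/-- The position clause of `IsFiniteEtaleCoveringOf`, read at the home edge `e₁` as an inclusion of
fibre-images. [cite: MochizukiSemiAnbd2006, Def. 2.2(i) p.23] -/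
private theorem range_subset_of_branchClause' (A : 𝒢.BObj) {e₁ e₂ : 𝒢.graph.Edge} (h : e₁ = e₂)
    (F : 𝒢.E e₁ ⥤ FintypeCat.{v₁}) {X : 𝒢.E e₁} (g : X ⟶ A.T e₁) (Q : π₀Obj (A.T e₂))
    (f : (Q.1 : 𝒢.E e₂) ⟶ (𝒢.transportE h).obj X)
    (hf : f ≫ (𝒢.transportE h).map g ≫ eqToHom (𝒢.transportE_obj_T A h) = Q.1.arrow) :
    Set.range (F.map (h ▸ Q : π₀Obj (A.T e₁)).1.arrow) ⊆ Set.range (F.map g) := by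
  subst h
  change f ≫ g ≫ eqToHom rfl = Q.1.arrow at hf
  rw [eqToHom_refl, Category.comp_id] at hf
  change Set.range (F.map Q.1.arrow) ⊆ _
  rintro x ⟨q, rfl⟩
  refine ⟨F.map f q, ?_⟩
  have := congrArg (fun k => F.map k q) hf
  simp only [F.map_comp, FintypeCat.comp_apply] at this
  exact this

/-- The position clause at a branch `b'` of `𝒢'` over the branch `b` of `𝒢`: the component `cE(e')`
of `T_e`, transported to the home edge `e = e(b)`, has fibre-image inside that of
`b^*(cV w) ↪ b^* S_v ⥲ T_e`, `w` the vertex of `b'`. [cite: MochizukiSemiAnbd2006, Def. 2.2(i) p.23] -/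
private theorem range_cE_subset (φ : Hom 𝒢' 𝒢) (A : 𝒢.BObj)
    (cV : ∀ v' : 𝒢'.graph.Vertex, π₀Obj (A.S (φ.base.vertexMap v')))
    (cE : ∀ e' : 𝒢'.graph.Edge, π₀Obj (A.T (φ.base.edgeMap e')))
    (hbr : ∀ (b' : 𝒢'.graph.Branch) (v' : 𝒢'.graph.Vertex) (h' : 𝒢'.graph.abuts b' = some v'),
      ∃ f : ((cE (𝒢'.graph.edgeOf b')).1 : 𝒢.E (φ.base.edgeMap (𝒢'.graph.edgeOf b'))) ⟶
          (𝒢.transportE (φ.base.edgeOf_branchMap b')).obj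
            ((𝒢.pull (φ.base.branchMap b') (φ.base.vertexMap v')
              (φ.base.abuts_branchMap b' v' h')).pullback.obj ((cV v').1 : 𝒢.V (φ.base.vertexMap v'))),
        f ≫ (𝒢.transportE (φ.base.edgeOf_branchMap b')).map
              ((𝒢.pull _ _ (φ.base.abuts_branchMap b' v' h')).pullback.map (cV v').1.arrow ≫
                (A.ψ (φ.base.branchMap b') (φ.base.vertexMap v') (φ.base.abuts_branchMap b' v' h')).hom) ≫
            eqToHom (𝒢.transportE_obj_T A (φ.base.edgeOf_branchMap b')) =
          (cE (𝒢'.graph.edgeOf b')).1.arrow)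
    (b' : 𝒢'.graph.Branch) (w : 𝒢'.graph.Vertex) (hw : 𝒢'.graph.abuts b' = some w)
    (b : 𝒢.graph.Branch) (hb : φ.base.branchMap b' = b)
    (h : 𝒢.graph.abuts b = some (φ.base.vertexMap w))
    (Fe : 𝒢.E (𝒢.graph.edgeOf b) ⥤ FintypeCat.{v₁})
    (he : 𝒢.graph.edgeOf b = φ.base.edgeMap (𝒢'.graph.edgeOf b')) :
    Set.range (Fe.map (he ▸ cE (𝒢'.graph.edgeOf b') : π₀Obj (A.T (𝒢.graph.edgeOf b))).1.arrow) ⊆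
      Set.range (Fe.map ((𝒢.pull b _ h).pullback.map (cV w).1.arrow ≫ (A.ψ b _ h).hom)) := by
  subst hb
  obtain ⟨f, hf⟩ := hbr b' w hw
  exact range_subset_of_branchClause' A (φ.base.edgeOf_branchMap b') Fe _ (cE _) f hf

/-- Among the two branches `b₁ ≠ b₂` of an edge `e`, every branch of `e` is one of them.
[cite: MochizukiSemiAnbd2006, §1 p.11] -/
private theorem eq_or_eq_of_edgeOf_eq {G : SemiGraph.{u}} {e : G.Edge} {b₁ b₂ : G.Branch}
    (hb12 : b₁ ≠ b₂) (hb₁ : G.edgeOf b₁ = e) (hb₂ : G.edgeOf b₂ = e) {β : G.Branch}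
    (hβ : G.edgeOf β = e) : β = b₁ ∨ β = b₂ := by
  obtain ⟨c₁, c₂, -, -, -, hall⟩ := G.two_branches e
  rcases hall β hβ with rfl | rfl
  · rcases hall b₁ hb₁ with rfl | rfl
    · exact Or.inl rfl
    · rcases hall b₂ hb₂ with rfl | rfl
      · exact Or.inr rfl
      · exact absurd rfl hb12
  · rcases hall b₁ hb₁ with rfl | rfl
    · rcases hall b₂ hb₂ with rfl | rfl
      · exact absurd rfl hb12
      · exact Or.inr rfl
    · exact Or.inl rfl

/-! ### The necessity direction for `v ≠ w` -/

/-- **[SemiAnbd] Example 2.8, coverticial half, necessity at `v`** (p. 31, for a closed edge joining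
two DISTINCT vertices): if `e` joins `v ≠ w` and `e` is sub-coverticial, then `Π_v` is nontrivial
at every basepoint.  (No hypothesis on the edge anabelioids is needed for this direction.)
[cite: MochizukiSemiAnbd2006, Ex. 2.8 p.31] -/
theorem nontrivial_of_isSubCoverticial_of_ne {e : 𝒢.graph.Edge} {v w : 𝒢.graph.Vertex}
    (hj : 𝒢.graph.Joins e v w) (hvw : v ≠ w) (hs : 𝒢.IsSubCoverticial e)
    (F : 𝒢.V v ⥤ FintypeCat.{v₁}) [FiberFunctor F] : Nontrivial (Aut F) := by
  classical
  by_contra hF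
  haveI : Subsingleton (Aut F) := not_nontrivial_iff_subsingleton.mp hF
  obtain ⟨b₁, b₂, hb12, hb₁, hb₂, ha₁, ha₂⟩ := hj
  obtain ⟨-, 𝒢', φ, ⟨A, hloc, -, -, -⟩, e₁, e₂, hne, hcov, hφ₁, hφ₂⟩ := hs
  obtain ⟨hprop, cV, cE, -, hEbij, -, -, hbr⟩ := hloc
  -- a branch `β₁` of `e₁` over `b₁`, abutting to a vertex `x` over `v`
  obtain ⟨β₁, x, hβ₁e, hβ₁b, hβ₁x, hx⟩ :=
    SemiGraph.exists_branch_preimage_abuts φ.base hprop e₁ b₁ (by rw [hφ₁, hb₁]) v ha₁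
  -- `e₂` meets `x` as well (coverticial), through a branch `β₂` which lies over `b₁` since `v ≠ w`
  obtain ⟨β₂, hβ₂e, hβ₂x⟩ := (hcov.2.2 x).mp ⟨β₁, hβ₁e, hβ₁x⟩
  have hβ₂b : φ.base.branchMap β₂ = b₁ := by
    have h1 : 𝒢.graph.edgeOf (φ.base.branchMap β₂) = e := by
      rw [φ.base.edgeOf_branchMap, hβ₂e, hφ₂]
    have h2 := φ.base.abuts_branchMap β₂ x hβ₂x
    rw [hx] at h2
    rcases eq_or_eq_of_edgeOf_eq hb12 hb₁ hb₂ h1 with h3 | h3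
    · exact h3
    · rw [h3, ha₂] at h2
      exact absurd (Option.some.inj h2).symm hvw
  -- work at the vertex `φ x = v` and the home edge `e(b₁)`
  subst hx
  have h : 𝒢.graph.abuts b₁ = some (φ.base.vertexMap x) := ha₁
  let Fe : 𝒢.E (𝒢.graph.edgeOf b₁) ⥤ FintypeCat.{v₁} := GaloisCategory.getFiberFunctor _
  let G : 𝒢.V (φ.base.vertexMap x) ⥤ FintypeCat.{v₁} := (𝒢.pull b₁ _ h).pullback ⋙ Fe
  haveI : FiberFunctor G := fiberFunctor_comp_of_exact _ _
  -- `Π_v = 1` at the basepoint `G` as well; the connected `P = cV x` has a one-point fibre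
  haveI : Subsingleton (Aut G) := by
    obtain ⟨i⟩ := nonempty_iso_of_fiberFunctor G F
    exact (Iso.conjAut i).toEquiv.subsingleton
  haveI : PreGaloisCategory.IsConnected ((cV x).1 : 𝒢.V (φ.base.vertexMap x)) := (cV x).2
  have hP : ∀ p q : G.obj ((cV x).1 : 𝒢.V (φ.base.vertexMap x)), p = q := by
    intro p q
    obtain ⟨σ, hσ⟩ := MulAction.exists_smul_eq (Aut G) p q
    rw [Subsingleton.elim σ 1, one_smul] at hσ
    exact hσ
  -- both components `cE e₁`, `cE e₂`, transported to `e(b₁)`, lie under `ψ_{b₁}(b₁^* P)`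
  have he₁ : 𝒢.graph.edgeOf b₁ = φ.base.edgeMap (𝒢'.graph.edgeOf β₁) := by rw [hβ₁e, hφ₁, hb₁]
  have he₂ : 𝒢.graph.edgeOf b₁ = φ.base.edgeMap (𝒢'.graph.edgeOf β₂) := by rw [hβ₂e, hφ₂, hb₁]
  have hsub₁ := range_cE_subset φ A cV cE hbr β₁ x hβ₁x b₁ hβ₁b h Fe he₁
  have hsub₂ := range_cE_subset φ A cV cE hbr β₂ x hβ₂x b₁ hβ₂b h Fe he₂
  -- the transported components are connected, so their fibres are nonempty: pick points
  let Q₁ : π₀Obj (A.T (𝒢.graph.edgeOf b₁)) := he₁ ▸ cE (𝒢'.graph.edgeOf β₁)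
  let Q₂ : π₀Obj (A.T (𝒢.graph.edgeOf b₁)) := he₂ ▸ cE (𝒢'.graph.edgeOf β₂)
  haveI hQ₁ : PreGaloisCategory.IsConnected (Q₁.1 : 𝒢.E (𝒢.graph.edgeOf b₁)) :=
    isConnected_eqRec_T A he₁ _
  haveI hQ₂ : PreGaloisCategory.IsConnected (Q₂.1 : 𝒢.E (𝒢.graph.edgeOf b₁)) :=
    isConnected_eqRec_T A he₂ _
  obtain ⟨q₁⟩ := nonempty_fiber_of_isConnected Fe (Q₁.1 : 𝒢.E (𝒢.graph.edgeOf b₁))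
  obtain ⟨q₂⟩ := nonempty_fiber_of_isConnected Fe (Q₂.1 : 𝒢.E (𝒢.graph.edgeOf b₁))
  obtain ⟨p₁, hp₁⟩ := hsub₁ ⟨q₁, rfl⟩
  obtain ⟨p₂, hp₂⟩ := hsub₂ ⟨q₂, rfl⟩
  -- the two fibre points coincide (the fibre of `b₁^* P` is a point)
  have hz : Fe.map Q₁.1.arrow q₁ = Fe.map Q₂.1.arrow q₂ := by
    rw [← hp₁, ← hp₂, hP p₁ p₂]
  -- hence the components coincide, and so do the edges `e₁`, `e₂`
  have hQ : Q₁ = Q₂ :=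
    component_eq_of_mem_range Fe Q₁ Q₂ ⟨q₁, rfl⟩ ⟨q₂, hz.symm⟩
  have hSig : (⟨φ.base.edgeMap (𝒢'.graph.edgeOf β₁), cE (𝒢'.graph.edgeOf β₁)⟩ : Σ f, π₀Obj (A.T f)) =
      ⟨φ.base.edgeMap (𝒢'.graph.edgeOf β₂), cE (𝒢'.graph.edgeOf β₂)⟩ := by
    rw [← sigma_mk_eqRec_T A he₁, ← sigma_mk_eqRec_T A he₂]
    exact congrArg (Sigma.mk (𝒢.graph.edgeOf b₁)) hQ
  rw [hβ₁e, hβ₂e] at hSig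
  exact hne (hEbij.1 hSig)

/-- **[SemiAnbd] Example 2.8, coverticial half, necessity at both ends**: if `e` joins `v ≠ w` and
`e` is sub-coverticial, then `Π_v` and `Π_w` are nontrivial (at every basepoint).
[cite: MochizukiSemiAnbd2006, Ex. 2.8 p.31] -/
theorem nontrivial_and_nontrivial_of_isSubCoverticial_of_ne {e : 𝒢.graph.Edge}
    {v w : 𝒢.graph.Vertex} (hj : 𝒢.graph.Joins e v w) (hvw : v ≠ w) (hs : 𝒢.IsSubCoverticial e) :
    (∀ (F : 𝒢.V v ⥤ FintypeCat.{v₁}) [FiberFunctor F], Nontrivial (Aut F)) ∧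
      ∀ (F : 𝒢.V w ⥤ FintypeCat.{v₁}) [FiberFunctor F], Nontrivial (Aut F) := by
  obtain ⟨b₁, b₂, hb12, hb₁, hb₂, ha₁, ha₂⟩ := hj
  exact ⟨fun F _ => nontrivial_of_isSubCoverticial_of_ne ⟨b₁, b₂, hb12, hb₁, hb₂, ha₁, ha₂⟩ hvw hs F,
    fun F _ => nontrivial_of_isSubCoverticial_of_ne ⟨b₂, b₁, hb12.symm, hb₂, hb₁, ha₂, ha₁⟩
      (Ne.symm hvw) hs F⟩

/-- **[SemiAnbd] Example 2.8, coverticial half, first conjunct — verbatim for an edge joining two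
distinct vertices**: for `𝒢` with trivial edge anabelioids and a closed edge `e` joining `v ≠ w`,
`e` is sub-coverticial iff `Π_v` and `Π_w` are nontrivial.  (At a loop `v = w` the "only if" fails,
`not_example_2_8_coverticial`; the named fact `example_2_8_coverticial` is this statement without
the hypothesis `v ≠ w`.) [cite: MochizukiSemiAnbd2006, Ex. 2.8 p.31] -/
theorem isSubCoverticial_iff_of_ne (hE : 𝒢.HasTrivialEdgeAnabelioids) {e : 𝒢.graph.Edge}
    {v w : 𝒢.graph.Vertex} (hj : 𝒢.graph.Joins e v w) (hvw : v ≠ w) :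
    𝒢.IsSubCoverticial e ↔
      (∀ (F : 𝒢.V v ⥤ FintypeCat.{v₁}) [FiberFunctor F], Nontrivial (Aut F)) ∧
        ∀ (F : 𝒢.V w ⥤ FintypeCat.{v₁}) [FiberFunctor F], Nontrivial (Aut F) :=
  ⟨nontrivial_and_nontrivial_of_isSubCoverticial_of_ne hj hvw,
    fun h => isSubCoverticial_of_nontrivial hE hj h.1 h.2⟩

end SemiGraphOfAnabelioids

end Literature.AnabelianGeometry.SemiGraphs
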